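import Literature.Analysis.FluidPDE.CorrectorFourierDefs
import HarnessLib

/-!
# Fourier-side data of the background and the synthesized solution of (3.2): definitions

Analysis/FluidPDE definition file (companion of `CorrectorFourierDefs`), naming the objects that
the last files of the discharge of
`Literature.Analysis.FluidPDE.Torus.CheskidovLuo2022LocalExistence` pass between each other
(Cheskidov–Luo 2022, arXiv:2009.06596, §3.1: the local solution `vᵢ` of (3.2) on `[tᵢ, tᵢ₊₁]`,
here on the model interval `[0, θ]` after translating time by `tᵢ`). For a background velocity
`u : ℝ → 𝕋^d → ℝ^d` and stress `R : ℝ → 𝕋^d → (d → ℝ^d)` (by columns, entry `Rₗⱼ = (R · j)ₗ`),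
jointly smooth on `[0, θ] × 𝕋^d`:

* `compC u j`, `entryC R l j` — the complexified scalar components `(uⱼ : ℂ)`, `(Rₗⱼ : ℂ)`;
* `driftFam θ u j`, `stressFam θ R l j` — their coefficient families on `[0, θ]`
  (`ScalarFourier.coeffFamily`: the Fourier coefficients of all one-sided time derivatives);
  `driftCoeff θ u j t = driftFam θ u j 0 (clamp θ t)`, `stressCoeff θ R l j t` — the zeroth
  members at clamped time, the Fourier-side data `U`, `RH` of `CorrectorFourier.picardMap`;
* `solCoeff θ u R = picardLim θ (driftCoeff θ u) (stressCoeff θ R)` — the coefficient field of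
  the solution; `presCoeffField θ u R t = presCoef (U(t), RH(t), c(t))` — the pressure
  coefficients;
* `velC θ u R l = torusSynth (solCoeff θ u R l)`, `presC θ u R = torusSynth (presCoeffField θ u R)`
  — the synthesized complex fields `∑ₖ c(l,t,k) e_k(x)`, `∑ₖ q̂(t,k) e_k(x)`;
* `vel θ u R t x = (Re Vₗ(t,x))ₗ ∈ ℝ^d`, `pres θ u R t x = Re Q(t,x)` — the real velocity and
  pressure (the complex fields are in fact real, `CorrectorFourierSymmetry`).

Only definitions and unfolding lemmas; all properties are proved in the sequel files.

## References

* A. Cheskidov, X. Luo, *Sharp nonuniqueness for the Navier–Stokes equations*, Invent. Math. 229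
  (2022) = arXiv:2009.06596, §3.1 (3.2). [`CheskidovLuo2022`]
* L. Grafakos, *Classical Fourier Analysis*, 3rd ed. (2014), §3.3.1 (Fourier inversion for
  absolutely summable coefficients). [`Grafakos2014`]
-/

noncomputable section

open MeasureTheory Real Set Filter Topology UnitAddTorus

namespace Literature.Analysis.FluidPDE

namespace CorrectorFourier

open ScalarFourier
open FourierNS (HasDecay clamp)

variable {d : Type*} [Fintype d]

/-! ### The complexified components of the background -/

/-- The complexified `j`-th component of a real vector field: `(t, x) ↦ (uⱼ(t, x) : ℂ)`. [folklore] -/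
def compC (u : ℝ → UnitAddTorus d → EuclideanSpace ℝ d) (j : d) : ℝ → UnitAddTorus d → ℂ :=
  fun t x => ((u t x j : ℝ) : ℂ)

omit [Fintype d] in
/-- Unfolding `compC`. [folklore] -/
@[simp]
theorem compC_apply (u : ℝ → UnitAddTorus d → EuclideanSpace ℝ d) (j : d) (t : ℝ) (x : UnitAddTorus d) :
    compC u j t x = ((u t x j : ℝ) : ℂ) := rfl

/-- The complexified entry `Rₗⱼ = (R · j)ₗ` of a real tensor field stored by columns:
`(t, x) ↦ ((R(t, x) j)ₗ : ℂ)`. [folklore] -/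
def entryC (R : ℝ → UnitAddTorus d → d → EuclideanSpace ℝ d) (l j : d) : ℝ → UnitAddTorus d → ℂ :=
  fun t x => ((R t x j l : ℝ) : ℂ)

omit [Fintype d] in
/-- Unfolding `entryC`. [folklore] -/
@[simp]
theorem entryC_apply (R : ℝ → UnitAddTorus d → d → EuclideanSpace ℝ d) (l j : d) (t : ℝ)
    (x : UnitAddTorus d) : entryC R l j t x = ((R t x j l : ℝ) : ℂ) := rfl

/-! ### Coefficient families and clamped coefficients of the background -/

/-- The **coefficient families of the drift components** on `[0, θ]`:
`driftFam θ u j i t k = 𝓕(∂ₜⁱ(uⱼ : ℂ)(t))(k)` (`ScalarFourier.coeffFamily`). [folklore] -/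
def driftFam (θ : ℝ) (u : ℝ → UnitAddTorus d → EuclideanSpace ℝ d) : d → ℕ → ℝ → (d → ℤ) → ℂ :=
  fun j => coeffFamily (Icc 0 θ) (compC u j)

/-- The **coefficient families of the stress entries** on `[0, θ]`:
`stressFam θ R l j i t k = 𝓕(∂ₜⁱ(Rₗⱼ : ℂ)(t))(k)`. [folklore] -/
def stressFam (θ : ℝ) (R : ℝ → UnitAddTorus d → d → EuclideanSpace ℝ d) :
    d → d → ℕ → ℝ → (d → ℤ) → ℂ :=
  fun l j => coeffFamily (Icc 0 θ) (entryC R l j)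

/-- The **drift coefficients at clamped time**, `Uⱼ(t) = 𝓕((uⱼ : ℂ)(clamp θ t))`: the
Fourier-side drift data of `CorrectorFourier.picardMap` (continuous on `ℝ`, constant outside
`[0, θ]`). [folklore] -/
def driftCoeff (θ : ℝ) (u : ℝ → UnitAddTorus d → EuclideanSpace ℝ d) : d → ℝ → (d → ℤ) → ℂ :=
  fun j t => driftFam θ u j 0 (clamp θ t)

/-- The **stress coefficients at clamped time**, `RHₗⱼ(t) = 𝓕((Rₗⱼ : ℂ)(clamp θ t))`. [folklore] -/
def stressCoeff (θ : ℝ) (R : ℝ → UnitAddTorus d → d → EuclideanSpace ℝ d) :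
    d → d → ℝ → (d → ℤ) → ℂ :=
  fun l j t => stressFam θ R l j 0 (clamp θ t)

/-- Unfolding `driftCoeff`: the Fourier coefficients of the complexified component at clamped
time. [folklore] -/
theorem driftCoeff_apply (θ : ℝ) (u : ℝ → UnitAddTorus d → EuclideanSpace ℝ d) (j : d) (t : ℝ)
    (k : d → ℤ) : driftCoeff θ u j t k = mFourierCoeff (compC u j (clamp θ t)) k := rfl

/-- Unfolding `stressCoeff`. [folklore] -/
theorem stressCoeff_apply (θ : ℝ) (R : ℝ → UnitAddTorus d → d → EuclideanSpace ℝ d) (l j : d)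
    (t : ℝ) (k : d → ℤ) : stressCoeff θ R l j t k = mFourierCoeff (entryC R l j (clamp θ t)) k := rfl

/-- On `[0, θ]` the clamped drift coefficients are the zeroth members of the drift families. [folklore] -/
theorem driftFam_zero_of_mem {θ : ℝ} (u : ℝ → UnitAddTorus d → EuclideanSpace ℝ d) (j : d) {t : ℝ}
    (ht : t ∈ Icc 0 θ) : driftFam θ u j 0 t = driftCoeff θ u j t := by
  simp only [driftCoeff, FourierNS.clamp_of_mem ht]

/-- On `[0, θ]` the clamped stress coefficients are the zeroth members of the stress families. [folklore] -/
theorem stressFam_zero_of_mem {θ : ℝ} (R : ℝ → UnitAddTorus d → d → EuclideanSpace ℝ d) (l j : d)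
    {t : ℝ} (ht : t ∈ Icc 0 θ) : stressFam θ R l j 0 t = stressCoeff θ R l j t := by
  simp only [stressCoeff, FourierNS.clamp_of_mem ht]

/-! ### The solution: coefficients, pressure coefficients, synthesized fields -/

variable [DecidableEq d]

/-- The **coefficient field of the local solution of (3.2)** on `[0, θ]` with background `(u, R)`:
the Picard limit of `CorrectorFourierPicard` for the data `driftCoeff θ u`, `stressCoeff θ R`
(`c(l, t, k) = 𝓕(vₗ(t))(k)` once synthesized). [folklore] -/
def solCoeff (θ : ℝ) (u : ℝ → UnitAddTorus d → EuclideanSpace ℝ d)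
    (R : ℝ → UnitAddTorus d → d → EuclideanSpace ℝ d) : d → ℝ → (d → ℤ) → ℂ :=
  picardLim θ (driftCoeff θ u) (stressCoeff θ R)

/-- The **pressure coefficient field** `q̂(t, k) = presCoef(U(t), RH(t), c(t))(k)`. [folklore] -/
def presCoeffField (θ : ℝ) (u : ℝ → UnitAddTorus d → EuclideanSpace ℝ d)
    (R : ℝ → UnitAddTorus d → d → EuclideanSpace ℝ d) : ℝ → (d → ℤ) → ℂ :=
  fun t k => presCoef (fun j => driftCoeff θ u j t) (fun i j => stressCoeff θ R i j t)
    (fun j => solCoeff θ u R j t) k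

/-- Unfolding `presCoeffField`. [folklore] -/
theorem presCoeffField_apply (θ : ℝ) (u : ℝ → UnitAddTorus d → EuclideanSpace ℝ d)
    (R : ℝ → UnitAddTorus d → d → EuclideanSpace ℝ d) (t : ℝ) (k : d → ℤ) :
    presCoeffField θ u R t k = presCoef (fun j => driftCoeff θ u j t)
      (fun i j => stressCoeff θ R i j t) (fun j => solCoeff θ u R j t) k := rfl

/-- The **synthesized complex velocity components** `Vₗ(t, x) = ∑ₖ c(l, t, k) e_k(x)`
(`ScalarFourier.torusSynth`; Grafakos 2014, §3.3.1). [folklore] -/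
def velC (θ : ℝ) (u : ℝ → UnitAddTorus d → EuclideanSpace ℝ d)
    (R : ℝ → UnitAddTorus d → d → EuclideanSpace ℝ d) (l : d) : ℝ → UnitAddTorus d → ℂ :=
  torusSynth (solCoeff θ u R l)

/-- The **synthesized complex pressure** `Q(t, x) = ∑ₖ q̂(t, k) e_k(x)`. [folklore] -/
def presC (θ : ℝ) (u : ℝ → UnitAddTorus d → EuclideanSpace ℝ d)
    (R : ℝ → UnitAddTorus d → d → EuclideanSpace ℝ d) : ℝ → UnitAddTorus d → ℂ :=
  torusSynth (presCoeffField θ u R)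

/-- The **velocity of the local solution**: the real vector field with components `Re Vₗ`
(the `Vₗ` are real, `CorrectorFourierSymmetry`). [folklore] -/
def vel (θ : ℝ) (u : ℝ → UnitAddTorus d → EuclideanSpace ℝ d)
    (R : ℝ → UnitAddTorus d → d → EuclideanSpace ℝ d) : ℝ → UnitAddTorus d → EuclideanSpace ℝ d :=
  fun t x => WithLp.toLp 2 fun l => (velC θ u R l t x).re

/-- The components of `vel`. [folklore] -/
@[simp]
theorem vel_apply (θ : ℝ) (u : ℝ → UnitAddTorus d → EuclideanSpace ℝ d)
    (R : ℝ → UnitAddTorus d → d → EuclideanSpace ℝ d) (t : ℝ) (x : UnitAddTorus d) (l : d) :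
    vel θ u R t x l = (velC θ u R l t x).re := rfl

/-- The **pressure of the local solution**: `Re Q`. [folklore] -/
def pres (θ : ℝ) (u : ℝ → UnitAddTorus d → EuclideanSpace ℝ d)
    (R : ℝ → UnitAddTorus d → d → EuclideanSpace ℝ d) : ℝ → UnitAddTorus d → ℝ :=
  fun t x => (presC θ u R t x).re

/-- Unfolding `pres`. [folklore] -/
@[simp]
theorem pres_apply (θ : ℝ) (u : ℝ → UnitAddTorus d → EuclideanSpace ℝ d)
    (R : ℝ → UnitAddTorus d → d → EuclideanSpace ℝ d) (t : ℝ) (x : UnitAddTorus d) :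
    pres θ u R t x = (presC θ u R t x).re := rfl

end CorrectorFourier

end Literature.Analysis.FluidPDE

end
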